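import Mathlib.Analysis.Complex.RemovableSingularity
import Mathlib.Analysis.Complex.AbsMax
import Mathlib.Analysis.Calculus.DSlope
import Mathlib.Analysis.Calculus.Deriv.Mul
import HarnessLib

/-!
# Small values at separated nodes control an entire function (solo-informed T62, analytic lemma)

A quantitative form of the remark "an entire function of exponential type cannot vanish on a set
of points of superlinear density" (Yoshida 1992, proof of Thm. 2, via Boas and Siegel), in which
exact zeros are replaced by small values at well-separated nodes, so that no limit object is
needed downstream:

* `exists_eq_nodePoly_mul` — an entire `H` vanishing on a finite set `Z` factors as
  `H(s) = (∏_{z ∈ Z} (s − z)) · G(s)` with `G` entire (removable singularities, `dslope`).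
* `lagrange_apply_node`, `norm_lagrange_le`, `differentiable_lagrange` — the Lagrange interpolant
  `L(s) = Σ_{x ∈ Z} F(x) ∏_{w ∈ Z, w ≠ x} (s − w)/(x − w)` written out (no new definition).
* `norm_le_of_small_on_separated_nodes` — if `F` is entire, the nodes `Z` lie in the closed disc
  of radius `r` about `s₀` and are pairwise `≥ d` apart, `|F| ≤ η` on `Z` and `|F| ≤ M` on the
  circle `|s − s₀| = 3r`, then
  `|F(s₀)| ≤ M / 2^{#Z} + 2 · #Z · η · (4r/d)^{#Z − 1}`
  (maximum modulus for `(F − L)/∏(s − z)` on `|s − s₀| = 3r`).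

References: H. Yoshida, Adv. Stud. Pure Math. 21 (1992) 281–325, proof of Thm. 2 (key
`Yoshida1992`); R. P. Boas, Entire functions (1954), §2.5 (Jensen). The estimate itself is
elementary and presumably folklore; no source states it in this form. [new]
-/

noncomputable section

open Complex Set Metric Filter Topology

namespace Summit.RiemannHypothesis.RiemannHypothesis.Theorems

/-- **Division by the node polynomial.** An entire function vanishing on a finite set `Z` is
`(∏_{z ∈ Z} (s − z)) · G(s)` with `G` entire. [folklore] -/
theorem exists_eq_nodePoly_mul {H : ℂ → ℂ} (hH : Differentiable ℂ H) (Z : Finset ℂ)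
    (hZ : ∀ z ∈ Z, H z = 0) :
    ∃ G : ℂ → ℂ, Differentiable ℂ G ∧ ∀ s, H s = (∏ z ∈ Z, (s - z)) * G s := by
  classical
  induction Z using Finset.induction_on generalizing H with
  | empty => exact ⟨H, hH, fun s ↦ by simp⟩
  | insert z₀ Z hz₀ ih =>
    have h0 : H z₀ = 0 := hZ z₀ (Finset.mem_insert_self _ _)
    have hH₁d : Differentiable ℂ (dslope H z₀) := by
      have h := (Complex.differentiableOn_dslope (univ_mem : (univ : Set ℂ) ∈ 𝓝 z₀)).2
        hH.differentiableOn
      exact differentiableOn_univ.1 h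
    have hfac : ∀ s, H s = (s - z₀) * dslope H z₀ s := fun s ↦ by
      have h := sub_smul_dslope H z₀ s
      rw [smul_eq_mul, h0, sub_zero] at h
      exact h.symm
    have hZ₁ : ∀ z ∈ Z, dslope H z₀ z = 0 := fun z hz ↦ by
      have hne : z ≠ z₀ := fun h ↦ hz₀ (h ▸ hz)
      have h := hfac z
      rw [hZ z (Finset.mem_insert_of_mem hz)] at h
      exact (mul_eq_zero.1 h.symm).resolve_left (sub_ne_zero.2 hne)
    obtain ⟨G, hG, hGe⟩ := ih hH₁d hZ₁
    refine ⟨G, hG, fun s ↦ ?_⟩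
    rw [Finset.prod_insert hz₀, hfac s, hGe s, mul_assoc]

/-- The Lagrange interpolant takes the prescribed values at the nodes. [folklore] -/
theorem lagrange_apply_node (F : ℂ → ℂ) (Z : Finset ℂ) {z : ℂ} (hz : z ∈ Z) :
    (∑ x ∈ Z, F x * ∏ w ∈ Z.erase x, (z - w) / (x - w)) = F z := by
  classical
  rw [Finset.sum_eq_single_of_mem z hz]
  · have h1 : ∏ w ∈ Z.erase z, (z - w) / (z - w) = 1 := by
      refine Finset.prod_eq_one fun w hw ↦ ?_
      have hne : z - w ≠ 0 := sub_ne_zero.2 (Finset.ne_of_mem_erase hw).symm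
      exact div_self hne
    rw [h1, mul_one]
  · intro x hx hxz
    have hzm : z ∈ Z.erase x := Finset.mem_erase.2 ⟨fun h ↦ hxz h.symm, hz⟩
    rw [Finset.prod_eq_zero hzm (by simp), mul_zero]

/-- The Lagrange interpolant is entire (a polynomial). [folklore] -/
theorem differentiable_lagrange (F : ℂ → ℂ) (Z : Finset ℂ) :
    Differentiable ℂ fun s ↦ ∑ x ∈ Z, F x * ∏ w ∈ Z.erase x, (s - w) / (x - w) := by
  refine Differentiable.fun_sum fun x _ ↦ ?_
  refine (Differentiable.fun_finsetProd fun w _ ↦ ?_).const_mul (F x)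
  exact (differentiable_id.sub_const w).div_const (x - w)

/-- Size of the Lagrange interpolant: if `|F| ≤ η` on the nodes, the nodes are pairwise `≥ d > 0`
apart and `|s − w| ≤ R` for every node `w`, then `|L(s)| ≤ #Z · η · (R/d)^{#Z − 1}`. [folklore] -/
theorem norm_lagrange_le (F : ℂ → ℂ) (Z : Finset ℂ) {s : ℂ} {η d R : ℝ} (hη : 0 ≤ η)
    (hd : 0 < d) (hR : 0 ≤ R) (hZη : ∀ z ∈ Z, ‖F z‖ ≤ η)
    (hsep : ∀ z ∈ Z, ∀ w ∈ Z, z ≠ w → d ≤ ‖z - w‖) (hs : ∀ w ∈ Z, ‖s - w‖ ≤ R) :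
    ‖∑ x ∈ Z, F x * ∏ w ∈ Z.erase x, (s - w) / (x - w)‖ ≤
      Z.card * η * (R / d) ^ (Z.card - 1) := by
  classical
  have hterm : ∀ x ∈ Z, ‖F x * ∏ w ∈ Z.erase x, (s - w) / (x - w)‖ ≤
      η * (R / d) ^ (Z.card - 1) := by
    intro x hx
    rw [norm_mul, norm_prod]
    refine mul_le_mul (hZη x hx) ?_ (Finset.prod_nonneg fun _ _ ↦ norm_nonneg _) hη
    have hfac : ∀ w ∈ Z.erase x, ‖(s - w) / (x - w)‖ ≤ R / d := by
      intro w hw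
      have hwZ : w ∈ Z := Finset.mem_of_mem_erase hw
      have hxw : x ≠ w := (Finset.ne_of_mem_erase hw).symm
      have hdw : d ≤ ‖x - w‖ := hsep x hx w hwZ hxw
      rw [norm_div]
      calc ‖s - w‖ / ‖x - w‖ ≤ R / ‖x - w‖ :=
            div_le_div_of_nonneg_right (hs w hwZ) (norm_nonneg _)
        _ ≤ R / d := div_le_div_of_nonneg_left hR hd hdw
    calc ∏ w ∈ Z.erase x, ‖(s - w) / (x - w)‖ ≤ ∏ _w ∈ Z.erase x, R / d :=
          Finset.prod_le_prod (fun _ _ ↦ norm_nonneg _) hfac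
      _ = (R / d) ^ (Z.card - 1) := by
          rw [Finset.prod_const, Finset.card_erase_of_mem hx]
  calc ‖∑ x ∈ Z, F x * ∏ w ∈ Z.erase x, (s - w) / (x - w)‖
      ≤ ∑ x ∈ Z, ‖F x * ∏ w ∈ Z.erase x, (s - w) / (x - w)‖ := norm_sum_le _ _
    _ ≤ ∑ _x ∈ Z, η * (R / d) ^ (Z.card - 1) := Finset.sum_le_sum hterm
    _ = Z.card * η * (R / d) ^ (Z.card - 1) := by
        rw [Finset.sum_const, nsmul_eq_mul, mul_assoc]

/-- **Small values at separated nodes.** Let `F` be entire, let the finite set `Z` of nodes lie in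
the closed disc of radius `r > 0` about `s₀` with pairwise distances `≥ d > 0`, and suppose
`|F| ≤ η` on `Z` and `|F| ≤ M` on the circle `|s − s₀| = 3r`. Then
`|F(s₀)| ≤ M / 2^{#Z} + 2 · #Z · η · (4r/d)^{#Z − 1}`.
Proof: `F − L = (∏(s − z)) · G` with `L` the Lagrange interpolant and `G` entire; on the circle
`|∏(s − z)| ≥ (2r)^{#Z}` and `|L| ≤ #Z η (4r/d)^{#Z−1}`, so the maximum modulus principle bounds
`|G(s₀)|`, while `|∏(s₀ − z)| ≤ r^{#Z}`. [new] -/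
theorem norm_le_of_small_on_separated_nodes {F : ℂ → ℂ} (hF : Differentiable ℂ F) (s₀ : ℂ)
    (Z : Finset ℂ) {r d M η : ℝ} (hr : 0 < r) (hd : 0 < d) (hη : 0 ≤ η)
    (hZr : ∀ z ∈ Z, ‖z - s₀‖ ≤ r) (hsep : ∀ z ∈ Z, ∀ w ∈ Z, z ≠ w → d ≤ ‖z - w‖)
    (hZη : ∀ z ∈ Z, ‖F z‖ ≤ η) (hM : ∀ s, ‖s - s₀‖ = 3 * r → ‖F s‖ ≤ M) :
    ‖F s₀‖ ≤ M / 2 ^ Z.card + 2 * Z.card * η * (4 * r / d) ^ (Z.card - 1) := by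
  classical
  set N : ℕ := Z.card with hN
  set L : ℂ → ℂ := fun s ↦ ∑ x ∈ Z, F x * ∏ w ∈ Z.erase x, (s - w) / (x - w) with hL
  set Λ : ℝ := N * η * (4 * r / d) ^ (N - 1) with hΛ
  have hΛ0 : 0 ≤ Λ := by positivity
  -- the interpolant: values at the nodes and size on the closed disc of radius `3r`
  have hLnode : ∀ z ∈ Z, L z = F z := fun z hz ↦ lagrange_apply_node F Z hz
  have hLbd : ∀ s, ‖s - s₀‖ ≤ 3 * r → ‖L s‖ ≤ Λ := by
    intro s hs
    refine norm_lagrange_le F Z hη hd (by positivity) hZη hsep fun w hw ↦ ?_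
    calc ‖s - w‖ = ‖(s - s₀) - (w - s₀)‖ := by ring_nf
      _ ≤ ‖s - s₀‖ + ‖w - s₀‖ := norm_sub_le _ _
      _ ≤ 3 * r + r := add_le_add hs (hZr w hw)
      _ = 4 * r := by ring
  -- division of `F − L` by the node polynomial
  have hHd : Differentiable ℂ (fun s ↦ F s - L s) := hF.sub (differentiable_lagrange F Z)
  obtain ⟨G, hG, hGe⟩ := exists_eq_nodePoly_mul hHd Z fun z hz ↦ by
    simp only [hLnode z hz, sub_self]
  -- the node polynomial on the circle and at the centre
  have hPlow : ∀ s, ‖s - s₀‖ = 3 * r → (2 * r) ^ N ≤ ‖∏ z ∈ Z, (s - z)‖ := by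
    intro s hs
    rw [norm_prod]
    calc (2 * r) ^ N = ∏ _z ∈ Z, 2 * r := by rw [Finset.prod_const]
      _ ≤ ∏ z ∈ Z, ‖s - z‖ := by
          refine Finset.prod_le_prod (fun _ _ ↦ by positivity) fun z hz ↦ ?_
          have h1 : ‖s - s₀‖ ≤ ‖s - z‖ + ‖z - s₀‖ := by
            calc ‖s - s₀‖ = ‖(s - z) + (z - s₀)‖ := by ring_nf
              _ ≤ ‖s - z‖ + ‖z - s₀‖ := norm_add_le _ _
          linarith [hZr z hz]
  have hPup : ‖∏ z ∈ Z, (s₀ - z)‖ ≤ r ^ N := by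
    rw [norm_prod]
    calc ∏ z ∈ Z, ‖s₀ - z‖ ≤ ∏ _z ∈ Z, r :=
          Finset.prod_le_prod (fun _ _ ↦ norm_nonneg _) fun z hz ↦ by
            rw [norm_sub_rev]; exact hZr z hz
      _ = r ^ N := Finset.prod_const _
  -- `G` on the circle, then at the centre by the maximum modulus principle
  have h2r : 0 < (2 * r) ^ N := by positivity
  have hGcirc : ∀ s ∈ frontier (ball s₀ (3 * r)), ‖G s‖ ≤ (M + Λ) / (2 * r) ^ N := by
    intro s hs
    rw [frontier_ball s₀ (by positivity : (3 : ℝ) * r ≠ 0), mem_sphere, dist_eq_norm] at hs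
    have hHs : ‖F s - L s‖ ≤ M + Λ :=
      (norm_sub_le _ _).trans (add_le_add (hM s hs) (hLbd s hs.le))
    rw [hGe s, norm_mul] at hHs
    rw [le_div_iff₀ h2r]
    calc ‖G s‖ * (2 * r) ^ N ≤ ‖G s‖ * ‖∏ z ∈ Z, (s - z)‖ :=
          mul_le_mul_of_nonneg_left (hPlow s hs) (norm_nonneg _)
      _ = ‖∏ z ∈ Z, (s - z)‖ * ‖G s‖ := mul_comm _ _
      _ ≤ M + Λ := hHs
  have hG0 : ‖G s₀‖ ≤ (M + Λ) / (2 * r) ^ N :=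
    Complex.norm_le_of_forall_mem_frontier_norm_le isBounded_ball hG.diffContOnCl hGcirc
      (subset_closure (mem_ball_self (by positivity)))
  -- assemble
  have hF0 : F s₀ = L s₀ + (∏ z ∈ Z, (s₀ - z)) * G s₀ := by
    linear_combination hGe s₀
  have hratio : r ^ N * ((M + Λ) / (2 * r) ^ N) = (M + Λ) / 2 ^ N := by
    have hr0 : r ≠ 0 := hr.ne'
    rw [mul_pow]
    field_simp
  calc ‖F s₀‖ = ‖L s₀ + (∏ z ∈ Z, (s₀ - z)) * G s₀‖ := by rw [hF0]
    _ ≤ ‖L s₀‖ + ‖∏ z ∈ Z, (s₀ - z)‖ * ‖G s₀‖ := by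
        refine (norm_add_le _ _).trans ?_
        rw [norm_mul]
    _ ≤ Λ + r ^ N * ((M + Λ) / (2 * r) ^ N) := by
        refine add_le_add (hLbd s₀ (by simp; positivity)) ?_
        exact mul_le_mul hPup hG0 (norm_nonneg _) (by positivity)
    _ = Λ + (M + Λ) / 2 ^ N := by rw [hratio]
    _ = M / 2 ^ N + (Λ + Λ / 2 ^ N) := by ring
    _ ≤ M / 2 ^ N + (Λ + Λ) := by
        have h1 : (1 : ℝ) ≤ 2 ^ N := one_le_pow₀ (by norm_num)
        have : Λ / 2 ^ N ≤ Λ := div_le_self hΛ0 h1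
        linarith
    _ = M / 2 ^ Z.card + 2 * Z.card * η * (4 * r / d) ^ (Z.card - 1) := by
        simp only [hΛ, hN]; ring

end Summit.RiemannHypothesis.RiemannHypothesis.Theorems

end
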